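import Summits.Ventures.HodgeRepro2.T5SU11LegendreOrthogonalLower
import Summits.Ventures.HodgeRepro2.T5SU11LegendreZeros
import Mathlib.LinearAlgebra.Lagrange

/-!
# Gauss–Legendre quadrature: the `n`-point rule with nodes at the zeros of `P_n` integrates every polynomial of
degree `≤ 2n − 1` exactly, with positive weights

With the `n`-element zero set `s` of `P_n` (row 400, `T5SU11LegendreZeros.legendre_zeros`), the Lagrange basis
`ℓ_i = Lagrange.basis s id i` (Mathlib's `Lagrange`) and the weights `w_i := ∫_{−1}^{1} ℓ_i(x) dx` (`weight s i`):

* every polynomial `f` of degree `< n` equals its interpolant `Σ_i f(x_i) ℓ_i`, so `∫ f = Σ_i w_i f(x_i)`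
  (`integral_eq_sum_weight_of_degree_lt`);
* for `deg f ≤ 2n − 1` divide by the monic Legendre polynomial `M_n = P_n/lc`: `f = q M_n + r`, `deg q < n`, `deg r < n`
  (`Polynomial.modByMonic_add_div`); `∫ q M_n = 0` by the orthogonality to lower degrees (row 406,
  `T5SU11LegendreOrthogonalLower`), `∫ r = Σ_i w_i r(x_i)` by interpolation, and `r(x_i) = f(x_i)` since `M_n(x_i) = 0`:

  **`∫_{−1}^{1} f(x) dx = Σ_{i ∈ s} w_i f(x_i)` for every `f ∈ ℝ[X]` with `natDegree f ≤ 2n − 1`**   (`gauss_legendre`);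

* applying the rule to `ℓ_i²` (degree `2n − 2`) gives `w_i = ∫ ℓ_i² > 0` (`weight_eq_integral_sq`, `weight_pos`: the
  support of `ℓ_i²` misses only the finitely many roots of `ℓ_i`), and to `f = 1`: `Σ_i w_i = 2` (`sum_weight`).

Nothing is claimed about (N).

Blind lane: Mathlib + the HodgeRepro2 prefix only; no sorry; axioms ⊆ {propext, Classical.choice,
Quot.sound}.
-/

namespace Summit.Ventures.HodgeRepro2.T5SU11GaussLegendre

open Polynomial intervalIntegral Finset Set MeasureTheory
open T5SU11SphericalLegendreAll T5SU11JacobiPhaseLawEven T5SU11JacobiLegendreLeading T5SU11LegendreIdentities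
  T5SU11LegendreOrthogonal T5SU11LegendreOrthogonalLower T5SU11LegendreZeros

/-! ### The monic Legendre polynomial -/

/-- **The monic Legendre polynomial** `M_n = P_n / lc(P_n)`. -/
noncomputable def legMonic (n : ℕ) : ℝ[X] := C (legLead n)⁻¹ * legPoly n

/-- `M_n` is monic. -/
theorem legMonic_monic (n : ℕ) : (legMonic n).Monic := by
  rw [Monic, legMonic, leadingCoeff_mul, leadingCoeff_C, leadingCoeff_legPoly, inv_mul_cancel₀ (legLead_pos n).ne']

/-- `natDegree M_n = n`. -/
theorem natDegree_legMonic (n : ℕ) : (legMonic n).natDegree = n := by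
  rw [legMonic, natDegree_C_mul (inv_ne_zero (legLead_pos n).ne'), natDegree_legPoly]

/-- `M_n(x) = P_n(x)/lc`. -/
theorem eval_legMonic (n : ℕ) (x : ℝ) : (legMonic n).eval x = (legLead n)⁻¹ * legP n x := by
  rw [legMonic, eval_mul, eval_C, ← legP_eq_eval]

/-- `M_n(x) = 0 ↔ P_n(x) = 0`. -/
theorem eval_legMonic_eq_zero_iff (n : ℕ) (x : ℝ) : (legMonic n).eval x = 0 ↔ legP n x = 0 := by
  rw [eval_legMonic]
  constructor
  · intro h
    rcases mul_eq_zero.mp h with h | h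
    · exact absurd h (inv_ne_zero (legLead_pos n).ne')
    · exact h
  · intro h
    rw [h, mul_zero]

/-- **`∫_{−1}^{1} q(x) M_n(x) dx = 0` for `natDegree q < n`.** -/
theorem integral_eval_mul_legMonic_eq_zero {n : ℕ} {q : ℝ[X]} (hq : q.natDegree < n) :
    ∫ x in (-1 : ℝ)..1, q.eval x * (legMonic n).eval x = 0 := by
  simp_rw [eval_legMonic, show ∀ x, q.eval x * ((legLead n)⁻¹ * legP n x) = (legLead n)⁻¹ * (q.eval x * legP n x)
    from fun x => by ring]
  rw [intervalIntegral.integral_const_mul, integral_eval_mul_legP_eq_zero_of_natDegree_lt hq, mul_zero]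

/-! ### The weights and the interpolatory rule -/

/-- **The Gauss–Legendre weights** `w_i = ∫_{−1}^{1} ℓ_i(x) dx`, `ℓ_i` the Lagrange basis of the node set `s`. -/
noncomputable def weight (s : Finset ℝ) (i : ℝ) : ℝ := ∫ x in (-1 : ℝ)..1, (Lagrange.basis s id i).eval x

/-- **The interpolatory rule**: for `degree f < #s`, `∫_{−1}^{1} f = Σ_{i ∈ s} w_i f(i)`. -/
theorem integral_eq_sum_weight_of_degree_lt (s : Finset ℝ) {f : ℝ[X]} (hf : f.degree < s.card) :
    ∫ x in (-1 : ℝ)..1, f.eval x = ∑ i ∈ s, weight s i * f.eval i := by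
  have hinj : Set.InjOn (id : ℝ → ℝ) s := Set.injOn_id _
  have hf' := Lagrange.eq_interpolate hinj hf
  conv_lhs => rw [hf', Lagrange.interpolate_apply]
  simp_rw [eval_finsetSum, eval_mul, eval_C, id]
  have hint : ∀ i ∈ s, IntervalIntegrable (fun x => f.eval i * (Lagrange.basis s id i).eval x) volume (-1 : ℝ) 1 :=
    fun i _ => (continuous_const.mul (Lagrange.basis s id i).continuous).intervalIntegrable _ _
  rw [integral_finsetSum hint]
  refine Finset.sum_congr rfl fun i _ => ?_
  rw [intervalIntegral.integral_const_mul, weight, mul_comm]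

/-! ### Gauss–Legendre quadrature -/

/-- **GAUSS–LEGENDRE QUADRATURE**: with `s` the `n`-element zero set of `P_n`, for every polynomial `f` of degree
`≤ 2n − 1`, `∫_{−1}^{1} f(x) dx = Σ_{i ∈ s} w_i f(x_i)`. -/
theorem gauss_legendre {n : ℕ} (hn : 1 ≤ n) {s : Finset ℝ} (hcard : s.card = n) (hs : ∀ r ∈ s, legP n r = 0)
    {f : ℝ[X]} (hf : f.natDegree ≤ 2 * n - 1) :
    ∫ x in (-1 : ℝ)..1, f.eval x = ∑ i ∈ s, weight s i * f.eval i := by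
  set M := legMonic n with hM
  have hMm : M.Monic := legMonic_monic n
  have hdiv := modByMonic_add_div f M
  set r := f %ₘ M with hr
  set q := f /ₘ M with hq
  have hrdeg : r.degree < s.card := by
    have := degree_modByMonic_lt f hMm
    rwa [degree_eq_natDegree hMm.ne_zero, natDegree_legMonic, ← hcard] at this
  have hqdeg : q.natDegree < n := by
    rw [hq, natDegree_divByMonic f hMm, natDegree_legMonic]
    omega
  have e : ∀ x, f.eval x = r.eval x + q.eval x * M.eval x := fun x => by
    conv_lhs => rw [← hdiv]
    rw [eval_add, eval_mul]
    ring
  have hnode : ∀ i ∈ s, f.eval i = r.eval i := fun i hi => by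
    rw [e, (eval_legMonic_eq_zero_iff n i).mpr (hs i hi), mul_zero, add_zero]
  simp_rw [e]
  have h1 : IntervalIntegrable (fun x => r.eval x) volume (-1 : ℝ) 1 := r.continuous.intervalIntegrable _ _
  have h2 : IntervalIntegrable (fun x => q.eval x * M.eval x) volume (-1 : ℝ) 1 :=
    (q.continuous.mul M.continuous).intervalIntegrable _ _
  rw [integral_add h1 h2, integral_eval_mul_legMonic_eq_zero hqdeg, add_zero,
    integral_eq_sum_weight_of_degree_lt s hrdeg]
  refine Finset.sum_congr rfl fun i hi => ?_
  rw [(eval_legMonic_eq_zero_iff n i).mpr (hs i hi), mul_zero, add_zero]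

/-! ### The weights are positive and sum to `2` -/

/-- **`w_i = ∫_{−1}^{1} ℓ_i(x)² dx`** (the rule applied to `ℓ_i²`, of degree `2n − 2`). -/
theorem weight_eq_integral_sq {n : ℕ} (hn : 1 ≤ n) {s : Finset ℝ} (hcard : s.card = n) (hs : ∀ r ∈ s, legP n r = 0)
    {i : ℝ} (hi : i ∈ s) : weight s i = ∫ x in (-1 : ℝ)..1, (Lagrange.basis s id i).eval x ^ 2 := by
  have hinj : Set.InjOn (id : ℝ → ℝ) s := Set.injOn_id _
  have hdeg : ((Lagrange.basis s id i) ^ 2).natDegree ≤ 2 * n - 1 := by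
    rw [natDegree_pow, Lagrange.natDegree_basis hinj hi, hcard]
    omega
  have h := gauss_legendre hn hcard hs hdeg
  simp_rw [eval_pow] at h
  rw [h, Finset.sum_eq_single i]
  · have h1 := Lagrange.eval_basis_self hinj hi
    simp only [id] at h1
    rw [h1]
    norm_num
  · intro j hj hji
    have h2 := Lagrange.eval_basis_of_ne (v := id) (Ne.symm hji) hj
    simp only [id] at h2
    rw [h2]
    norm_num
  · intro h
    exact absurd hi h

/-- **The weights are positive.** -/
theorem weight_pos {n : ℕ} (hn : 1 ≤ n) {s : Finset ℝ} (hcard : s.card = n) (hs : ∀ r ∈ s, legP n r = 0)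
    {i : ℝ} (hi : i ∈ s) : 0 < weight s i := by
  rw [weight_eq_integral_sq hn hcard hs hi]
  have hinj : Set.InjOn (id : ℝ → ℝ) s := Set.injOn_id _
  set ℓ := Lagrange.basis s id i with hℓ
  have hℓ0 : ℓ ≠ 0 := Lagrange.basis_ne_zero hinj hi
  have hnn : (0 : ℝ → ℝ) ≤ᵐ[volume] fun x => ℓ.eval x ^ 2 :=
    Filter.Eventually.of_forall fun x => by positivity
  have hint : IntervalIntegrable (fun x => ℓ.eval x ^ 2) volume (-1 : ℝ) 1 :=
    (ℓ.continuous.pow 2).intervalIntegrable _ _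
  rw [integral_pos_iff_support_of_nonneg_ae hnn hint]
  refine ⟨by norm_num, ?_⟩
  -- the support of `ℓ²` contains `Ioc (−1) 1` minus the (finitely many) roots of `ℓ`
  have hsub : Ioc (-1 : ℝ) 1 \ {x | IsRoot ℓ x} ⊆ Function.support (fun x => ℓ.eval x ^ 2) ∩ Ioc (-1) 1 := by
    intro x hx
    refine ⟨?_, hx.1⟩
    rw [Function.mem_support]
    exact pow_ne_zero 2 hx.2
  calc (0 : ENNReal) < volume (Ioc (-1 : ℝ) 1) := by rw [Real.volume_Ioc]; norm_num
    _ = volume (Ioc (-1 : ℝ) 1 \ {x | IsRoot ℓ x}) :=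
        (measure_sdiff_null ((finite_setOf_isRoot hℓ0).measure_zero volume)).symm
    _ ≤ volume (Function.support (fun x => ℓ.eval x ^ 2) ∩ Ioc (-1) 1) := measure_mono hsub

/-- **`Σ_{i ∈ s} w_i = 2`** (the rule applied to `f = 1`). -/
theorem sum_weight {n : ℕ} (hn : 1 ≤ n) {s : Finset ℝ} (hcard : s.card = n) (hs : ∀ r ∈ s, legP n r = 0) :
    ∑ i ∈ s, weight s i = 2 := by
  have h := gauss_legendre hn hcard hs (f := 1) (by rw [natDegree_one]; omega)
  simp only [eval_one, mul_one] at h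
  rw [← h]
  norm_num

/-- **Gauss–Legendre quadrature for the Legendre zero set itself** (the packaged form): there is an `n`-element set
`s ⊂ (−1, 1)` of nodes — the zeros of `P_n` — with positive weights summing to `2`, integrating every polynomial
of degree `≤ 2n − 1` exactly. -/
theorem exists_gauss_legendre_rule {n : ℕ} (hn : 1 ≤ n) :
    ∃ s : Finset ℝ, s.card = n ∧ (∀ r ∈ s, r ∈ Ioo (-1 : ℝ) 1) ∧ (∀ r ∈ s, legP n r = 0)
      ∧ (∀ i ∈ s, 0 < weight s i) ∧ ∑ i ∈ s, weight s i = 2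
      ∧ ∀ f : ℝ[X], f.natDegree ≤ 2 * n - 1 → ∫ x in (-1 : ℝ)..1, f.eval x = ∑ i ∈ s, weight s i * f.eval i := by
  obtain ⟨s, hcard, hmem, hiff, -⟩ := legendre_zeros n
  have hs : ∀ r ∈ s, legP n r = 0 := fun r hr => (hiff r).mpr hr
  exact ⟨s, hcard, hmem, hs, fun i hi => weight_pos hn hcard hs hi, sum_weight hn hcard hs,
    fun f hf => gauss_legendre hn hcard hs hf⟩

end Summit.Ventures.HodgeRepro2.T5SU11GaussLegendre
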